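import Mathlib
import HarnessLib
import HarnessLib.Audit
import Summits.CriticalPhenomena.Statement
import Literature.Barriers.CriticalPhenomena.RandomClusterFirstOrder
import HarnessLib.Audit.Status.Attr

/-!
Route: ArmDressing

# Route ArmDressing — Möbius-invariant FK ball-connectivity skeleton dressed by covariant one-arm
factors (Camia–Feng transferred to Z^3)

TRANSFER of the percolation-style proof of conformal covariance of spin correlations (Camia2023 for
site percolation, Thm 1.1; CamiaFeng2025 for
the planar FK-Ising model, Thm 1 and Cor 2: a^(-n/8) P[G(Q; z)] converges to conformally covariant
limits and the Edwards–Sokal even-partition sum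
gives the CHI theorem back "without s-holomorphicity except through CLE") to the critical FK-Ising
(q = 2) representation of the n.n. Ising model
on Z^3 at beta_c(3) (wired boxes Lambda_L, L -> infinity). It suffices to show X =
OneArmRenormalisedLimit: with the ONE-ARM RENORMALISATION
rho(delta) := 1 / phi_(p_c,2)[0 <-> (B_(1/delta))^c] (the inverse probability that the origin is
joined by an open FK path to lattice distance
1/delta), the renormalised critical spin correlators rho(delta)^n <sigma_[x_1/delta] ...
sigma_[x_n/delta]>+ converge locally uniformly on
non-coincident configurations to a family S with S_2 > 0 that is Möbius covariant with ONE weight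
Delta > 0 — Delta being the one-arm exponent of
critical 3D FK-Ising, an OUTPUT of the route (no two-point power law, no exponent and no isotropy of
correlators is imported). X is reached from
three ranked cruxes that are the 3D transposition of the three engines of the planar proof — A =
BallConnectivityMoebius (what is left of
CLE_(16/3): Möbius INVARIANCE of the weight-free connection laws of finite families of generalised
balls), C = ArmExtensionFactorisation and
B = EvenPatternDecoupling (what replaces RSW circuits: Kesten one-arm decoupling, uniqueness of the
annulus-crossing cluster, ratio mixing) —
plus the shared non-Gaussianity crux NG (item 0636) for clause (iii), and two provable supports
(InfiniteVolumeEdwardsSokal, ArmDressingGlue).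
Lean: `open Literature.Probability.LatticeModels Literature.Probability.Percolation
Literature.Barriers.CriticalPhenomena Filter Topology in let E3 := EuclideanSpace ℝ (Fin 3); let μ :
(L : ℕ) → MeasureTheory.Measure (BondConfig (BoxV 3 L)) := fun L => rcMeasure (boxGraph 3 L)
(fkIsingParam (criticalBeta 3)) 2 (boxBoundary 3 L); let PrL : (m : ℕ) → (Fin m → Set (Site 3)) →
Set (Fin m → Fin m → Prop) → ℕ → ℝ := fun _ K R L => (μ L).real {ω | (fun i j => ∃ x y : BoxV 3 L,
x.1 ∈ K i ∧ y.1 ∈ K j ∧ (openGraph ω).Reachable x y) ∈ R}; let Pr : (m : ℕ) → (Fin m → Set (Site 3))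
→ Set (Fin m → Fin m → Prop) → ℝ := fun m K R => limUnder atTop (PrL m K R); let mesh : ℝ → Site 3 →
E3 := fun δ z => WithLp.toLp 2 fun i : Fin 3 => δ * (z i : ℝ); let disc : ℝ → Set E3 → Set (Site 3)
:= fun δ A => {x | mesh δ x ∈ A}; let arm1 : ℝ → ℝ → ℝ := fun δ r => Pr 2 ![{(0 : Site 3)}, disc δ
(Metric.ball (0 : E3) r)ᶜ] {R | R 0 1}; (∀ δ ∈ Set.Ioc (0:ℝ) 1, 0 < arm1 δ 1) ∧ ∃ (Δ : ℝ) (S :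
CorrFamily 3), 0 < Δ ∧ HasPointwiseScalingLimit (criticalCorr 3) (fun δ => (arm1 δ 1)⁻¹) S ∧
IsNondegenerateTwoPoint S ∧ IsMoebiusCovariant Δ S`

## Assembly
The deciding theorem `closes` (glue.lean, certified) takes the three own cruxes A, C, B, the shared
crux NonGaussianLimit and the two supports
InfiniteVolumeEdwardsSokal, ArmDressingGlue: ArmDressingGlue applied to (ES, A, B, C) yields
OneArmRenormalisedLimit = (arm1 > 0) ∧ ∃ Delta S …;
with rho := 1/arm1(·,1) > 0 on (0,1], NonGaussianLimit rho S gives HasNontrivialU4 S, and ⟨rho,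
Delta, S, …⟩ is Ising3DConformalLimit
(root abbrev of Literature.Probability.LatticeModels.CritIsing3DConformalLimit) — five lines of
logic, rc 0 in Sketch.lean. The Assembly
item below is that same frame with the glue as an explicit hypothesis (pure logic, provable now);
the mathematics of the assembly is the
support ArmDressingGlue.

Rationale: WHY THIS LINE. Both solved siblings of the payload reach conformal covariance of POINT functions
through the same two-storey architecture: a conformally
INVARIANT macroscopic skeleton (crossing / loop events: Smirnov2001, CamiaNewman2006,
KemppainenSmirnov2017) and COVARIANT local dressing by
one-arm factors (GarbanPeteSchramm2013Pivotal; Camia2023 Thm 1.1; CamiaFeng2025 Thm 1, Lemmas 12–17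
and §3.2.3, held as paper:arxiv-2411.01467,
p.4: "for our results involving only vertices in the bulk, the convergence of interfaces to CLE_16/3
is the only place where s-holomorphicity
is used"). Laying that proof out step by step for Z^3 (NOTES.md, transfer table): L0 Edwards–Sokal
even-partition identity transfers verbatim;
L1 (CLE) is the FIRST step that breaks — no discrete holomorphicity, no Loewner chains, and
LiouvilleRigidityNarrow says no uniformisation — so
its minimal consumable residue, Möbius invariance of connection laws among GENERALISED BALLS (closed
balls and closed exteriors: the one
Möbius-closed class of probes, on which inversion acts by an explicit centre/radius formula),
becomes crux A; L2–L4 (one-arm coupling,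
reduction to loop events, normalisation by the one-arm power) break a SECOND structure, the open
CIRCUITS supplied by RSW (they merge all
annulus-crossing clusters, screen boundary conditions and decouple the start of an arm from the far
field), and open separating SHELLS have
vanishing probability at criticality in d = 3, so their statements must be re-founded on Kesten-type
one-arm conditioning and mixing of the
critical FK-Ising / random-current measures (Kesten1986; Panis2025 Thm 1.1/2.4 and Open Problem 1;
AizenmanDuminilCopinAnnals2021 §6;
DuminilCopinHonglerNolin2011 for the planar ratio mixing) — cruxes B and C, typed as the two
operational double-ratio limits the covariance
argument consumes; L5–L6 (one-arm scaling by Cesàro/multiplicativity, covariance bookkeeping with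
balls mapped to balls) transfer and are
inside the support ArmDressingGlue. Imported area: percolation scaling-limit technology (arm events,
IIC, ratio mixing) applied to FK-Ising
clusters, where FKG, domain Markov and free/wired bracketing are available. What it does that the 43
open routes do not: the nearest,
CurrentConnectionInvariance, also has a weight-free invariance target, but for POINT ratios of
double currents glued by the exact switching
identity, and it imports the two-point isotropic pure power law (item 0634) for the weights; here
the weights |phi'(x_i)|^(-Delta) are
MANUFACTURED by the one-arm dressing (Delta = one-arm exponent, isotropy and the pure power law S_2
= c|x-y|^(-2 Delta) are outputs), the bridge
is mesoscopic (Kesten decoupling at shrinking balls), and the renormalisation is the one-point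
function rho = 1/pi_1, used by no route.

RANKED CRUXES. #0 OneArmRenormalisedLimit (target) — X: the one-arm probability arm1(delta,1) =
phi[0 <-> (B_(1/delta))^c] (infinite-volume limit of wired critical FK-Ising boxes on Z^3) is
positive, and there are Delta > 0 and S with HasPointwiseScalingLimit (criticalCorr 3) (1/arm1(·,1))
S, S_2 > 0 on non-coincident pairs, IsMoebiusCovariant Delta S — clauses (i),(ii) of the conjunct
with the renormalisation PINNED to the one-arm probability (CamiaFeng2025 remark after Thm 1:
without Wu's theorem the normalisation a^(1/8) is replaced by P[0 <-> dB_1]). (why it might fail: it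
is the conjunct's (i)+(ii) with a specific rho: fails if rho must carry log-corrections relative to
the one-arm probability (one-arm and sqrt(two-point) not comparable: a hyperscaling violation
expected only for d > 4), or if (ii) fails.) [CamiaFeng2025, Camia2023, DuminilCopinICM2022,
PolandRychkovVichi2019]
#2 BallConnectivityMoebius (crux) — THE CLE RESIDUE (first failing step L1 of the sibling proof).
For every m and every set R of relations on m indices, the probability that the critical FK-Ising
connection relation among the discretisations at mesh delta of m GENERALISED BALLS (data (c_i, r_i):
r_i > 0 the closed ball, r_i < 0 the closed exterior of the open ball of radius |r_i|) lies in R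
converges as delta -> 0+ to a limit lam(data) which is continuous in the data and INVARIANT under
translations, dilations, O(3) and the unit inversion (acting on data by (c, r) -> (c/(|c|^2 - r^2),
r/(|c|^2 - r^2)), which maps generalised balls to generalised balls exactly) — the 3D Cardy–Smirnov
statement: weight-free, renormalisation-free, exponent-free. [difficulty: open-problem] (why it
might fail: the inversion clause is the summit's conformal content in percolation clothing: false if
critical 3D FK-Ising clusters were scale- but not Möbius-invariant (no mechanism known; numerics
only for q=1, GoriTrombettoni2015); full-filter existence and continuity at tangencies also open.)
[Camia2023, CamiaFeng2025, KemppainenSmirnov2017, Smirnov2001, GoriTrombettoni2015,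
PolandRychkovVichi2019, Literature.Barriers.CriticalPhenomena.LiouvilleRigidityNarrow,
Literature.Barriers.CriticalPhenomena.ScaleCovarianceNotMoebius]
#3 ArmExtensionFactorisation (crux) — THE 3D SUBSTITUTE FOR RSW CIRCUITS, NORMALISATION HALF
(CamiaFeng2025 Lemmas 15–17 transposed; = Kesten one-arm conditioning + uniqueness of the
annulus-crossing cluster + mixing). For n >= 1 points z_j inside pairwise disjoint closed balls D_j:
(i) the joint arm probability phi[z_j^delta <-> (D_j^c)^delta for all j] divided by arm1(delta,1)^n
converges locally uniformly to a continuous v(z) > 0; (ii) v(z) = lim_(eta->0) W(eta) / prod_j w(eta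
a_j) for every choice of multipliers a_j > 0, where W(eta) is the delta -> 0 then (inner radius ->
0) limit of the ratio P[inner balls around z_j <-> D_j^c, all j] / P[inner balls <-> B(z_j, eta
a_j)^c, all j] — the SAME limit for every family of inner closed balls shrinking to the points
(Kesten: the far field forgets how the arm starts) — and w(eta) is the analogous one-point ratio at
the origin (outer B(0,1), middle B(0,eta)); this encodes asymptotic independence of the n
point-to-mesoscopic arms (mixing) and the cancellation of the microscopic hooking factors.
[difficulty: XL] (why it might fail: no RSW/BK in d=3: needs P[two disjoint clusters cross
A(r,R)]/P[cross] -> 0 as R/r -> infinity and a one-arm IIC (Panis2025 Open Problem 1, open; even a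
polynomial rate for <sigma_0>+_(Lambda_R) at beta_c(3) is unproved); false above d_c = 4 where wired
spheres over-magnetise (a(R)^2 >> G(R)).) [CamiaFeng2025, Panis2025, Kesten1986,
AizenmanDuminilCopinAnnals2021, GarbanPeteSchramm2013Pivotal, DuminilCopinHonglerNolin2011,
KozmaNachmias2011, AizenmanDuminilCopinSidoravicius2015]
#4 EvenPatternDecoupling (crux) — THE 3D SUBSTITUTE FOR RSW CIRCUITS, PATTERN HALF (CamiaFeng2025
Lemmas 12 and 14 transposed). For even n >= 2 and points z_j inside pairwise disjoint closed balls
D_j: (i) the conditional probability P[EVEN(z): every open cluster contains an even number of the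
points z_j^delta | z_j^delta <-> (D_j^c)^delta for all j] converges locally uniformly to a
continuous q(z) > 0; (ii) q(z) equals the eta -> 0 limit of the delta -> 0 limits of P[EVEN among
inner balls, and inner ball_j <-> D_j^c for all j] / P[inner ball_j <-> D_j^c for all j] for EVERY
family of inner closed balls of radii -> 0 containing the points well inside — point-conditioning =
ball-conditioning (Kesten decoupling), with the even pattern read on the unique crossing clusters.
[difficulty: L] (why it might fail: needs uniqueness of the cluster crossing B(z,eta) -> D^c as eta
-> 0 (no circuits to merge crossings in 3D; no BK for q=2) and locality of the arm-conditioned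
measure (one-arm IIC, Panis2025 Open Problem 1); EVEN is non-monotone, so FKG sandwiching alone
cannot give (ii).) [CamiaFeng2025, Camia2023, GarbanPeteSchramm2013Pivotal, Panis2025,
AizenmanDuminilCopinAnnals2021, Kesten1986]
#5 NonGaussianLimit (crux) — shared item stmt-CriticalPhenomena-0636 verbatim (wanted by
IsingEuclidUpgrade, HyperoctahedralRP, PerfectScreening, …): every non-degenerate pointwise scaling
limit of the renormalised critical correlators on Z^3 (any rho > 0 on (0,1]) has U_4 not identically
zero — clause (iii), imported; this route does not attack it. [difficulty: open-problem] (why it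
might fail: it is clause (iii) itself for every renormalisation: fails iff some non-degenerate limit
of critical 3D Ising is Gaussian (two independent sourced currents avoid each other at macroscopic
separation), which would refute the conjunct.) [Aizenman1982, AizenmanDuminilCopinAnnals2021,
DuminilCopinICM2022]
#9 InfiniteVolumeEdwardsSokal (support) — (a) for every finite family of lattice sets whose infinite
members pairwise intersect and every relation set R, the wired-box probabilities PrL(L) of "the
connection relation lies in R" converge as L -> infinity (weak limit of wired critical FK-Ising
measures + no percolation at p_c(2) on Z^3, AizenmanDuminilCopinSidoravicius2015; Grimmett2006 Thm
4.19, Prop 5.11), so every Pr in the cruxes is a genuine limit; (b) arm1(delta,1) > 0 on (0,1]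
(Griffiths: >= <sigma_0 sigma_x> > 0); (c) Edwards–Sokal with + boundary in infinite volume at
beta_c: criticalCorr 3 n x = Pr[EVEN(x)] for injective x (finite-volume ES with the boundary cluster
frozen +, isingCorr_plus_box_eq_rcMeasure_real pattern, then L -> infinity using m*(beta_c) = 0:
spontaneousMagnetization_criticalBeta_eq_zero). [difficulty: provable-now] [EdwardsSokal1988,
Grimmett2006, AizenmanDuminilCopinSidoravicius2015, CamiaFeng2025]
#9 ArmDressingGlue (support) — the covariance bookkeeping of CamiaFeng2025 §3.2.2–3.2.3 transposed
to R^3 (pure real analysis given the items): InfiniteVolumeEdwardsSokal -> BallConnectivityMoebius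
-> EvenPatternDecoupling -> ArmExtensionFactorisation -> OneArmRenormalisedLimit. Proof plan: S_n(z)
:= q(z) v(z) (independent of the outer balls D since the left side rho^n P[EVEN] is); odd n and n =
0 by parity/normalisation; dilations EXACT on the lattice (latticeApprox delta (kappa z) =
latticeApprox (delta/kappa) z, arm1 delta (kappa r) = arm1 (delta/kappa) r) give S_n(kappa z) =
t(kappa)^n S_n(z) with t multiplicative and monotone, hence t(kappa) = kappa^(-Delta), Delta in
[1/2,1] by the proved two-point window (scalingDimension_mem_Icc_holds);
translations/O(3)/inversion: express q, v through lam-ratios by B(ii), C(ii), apply A (the images of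
the inner and middle balls under the map are again shrinking/middle balls: inner-family independence
and antitonicity in the middle ball absorb the O(eta^2) off-centring), and read the weight prod_j
|z_j|^(2 Delta) off w(eta/s_j)/w(eta) -> s_j^(-Delta), s_j = |z_j|^(-2); Delta_inversion =
Delta_dilation by conjugating a dilation with the inversion. [difficulty: provable-now]
[CamiaFeng2025, Camia2023]
#9 OneArmExponent (support) — milestone dividend (provable from ArmExtensionFactorisation at n = 1
plus the dilation part of the glue and the proved two-point window): the one-arm exponent of
critical FK-Ising on Z^3 exists as a RATIO LIMIT, arm1(delta, r)/arm1(delta, 1) -> r^(-Delta) with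
Delta in [1/2, 1] (prediction Delta = Delta_sigma = 0.5181489). [difficulty: M] [Panis2025,
KozmaNachmias2011, LawlerSchrammWerner2002OneArm, PolandRychkovVichi2019]

TWO-LAYER PLAN. Foreseen glued splits (not filed now): ArmExtensionFactorisation ⇐
CrossingClusterUnique (P[two disjoint clusters cross A(r,R)] = o(P[cross]) as
R/r -> infinity) → OneArmIIC (Kesten conditioning: the law outside B_r given 0 <-> dB_R converges as
r/R -> 0, Panis Open Problem 1 in ratio
form) → ArmExtensionFactorisation; EvenPatternDecoupling ⇐ CrossingClusterUnique → OneArmIIC →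
EvenPatternDecoupling (same two children, shared);
BallConnectivityMoebius ⇐ BallLawsExist (existence + continuity + similarity invariance,
compactness/uniqueness) → BallLawsInversion (the one
conformal generator) → BallConnectivityMoebius.

KILL CRITERIA. A theorem or solid numerics showing NON-invariance of a generalised-ball connection
law under the unit inversion (e.g. three-ball connection
probabilities of critical 3D FK-Ising differing between a configuration and its inverted image
beyond finite-size drift) closes the route
`refuted:BallConnectivityMoebius` — and, with B and C, would refute conformal covariance of the 3D
Ising spin correlations themselves. A proof that
annulus-crossing clusters are NOT asymptotically unique in d = 3 (liminf P[>= 2 disjoint crossing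
clusters of A(r,R)]/P[cross] > 0 as R/r -> infinity),
or that wired spheres enhance bulk two-point functions by an unbounded factor at beta_c(3), refutes
B/C as typed: pivot to a dressing by the
two-point IIC of Panis2025 (conditioning on 0 <-> x instead of one-arm events; renormalisation rho =
G(1/delta)^(-1/2)) keeping A. If item 1344
(MoebiusLimitExists) is proved elsewhere the covariance half is moot and the route retires
`superseded`; NonGaussianLimit refuted kills the summit.

NOT DECOMPOSED YET. The two children CrossingClusterUnique / OneArmIIC (layer 2, after a prover
reports which half of C resists); polynomial RATES (ratio mixing
exponents), which the operational cruxes deliberately avoid by asserting limits only; boundary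
versions (half-space probes, boundary one-arm
exponent) and energy-sector connectivities (CamiaFeng2025 §1.5) — other theses; the identification
Delta = Delta_sigma with the two-point
decay exponent eta via 2 Delta = 1 + eta (follows from the target and isingScalingRelationHolds once
EtaExists, not needed for the conjunct).

CHEAPEST FALSIFIER. Monte Carlo, q = 2 Swendsen–Wang/Wolff on Z^3 at beta_c = 0.22165463 (FK
clusters come for free): (1) inversion test of crux A — connection
probabilities of three lattice balls {B(c_i, r_i)} versus the inverted family {B(c_i*, r_i*)}
(different shapes and distances, predicted EQUAL in the
limit), sizes L = 64–256, in the spirit of GoriTrombettoni2015 (who saw Möbius invariance of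
crossing probabilities for q = 1 in d = 3); (2) the
uniqueness input of B/C — frequency of two disjoint clusters crossing A(r, 8r), r = 4..16, must
decay in r/R; (3) the one-arm ratio
a(2R)/a(R) -> 2^(-0.518) (wired + ball magnetisation at the centre). Not run in this planning
session (no kit budget in payload); a trivial
commutant/lookup falsifier does not exist for this line. Lookup done: no 3D conformal-covariance
theorem or test for FK-Ising connectivities
found (lit search / galaxy, 2026-08-16).

NUMBERS. Delta_sigma(3D Ising) = 0.5181489(10) (conformal bootstrap, PolandRychkovVichi2019), so the
predicted one-arm exponent of 3D FK-Ising is 0.518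
and the FK cluster dimension 3 - 0.518 = 2.482; planar calibration: one-arm exponent 1/8, a^(-n/8)
normalisation (CamiaFeng2025 Thm 1, Wu1966),
5/48 for percolation (LawlerSchrammWerner2002OneArm, Camia2023); rigorous 3D window 1 <= 2 Delta <=
2 (criticalTwoPoint bounds, in tree);
beta_c(3) = 0.221654626(5), p_c = 1 - exp(-2 beta_c) = 0.3581. Items at open: 9 (1 target, 1
assembly, 4 cruxes incl. 1 shared, 3 supports).

DEFINITION REQUESTS. None blocking: all items are typed over rcMeasure / boxGraph / boxBoundary
(wired FK-Ising boxes), openGraph/Reachable, mesh (= meshPos of PlusDomainCorr, inlined so the route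
file does not import it), latticeApprox,
criticalCorr, HasPointwiseScalingLimit, IsMoebiusCovariant with local `let` headers. Nice-to-have
Literature notions (would shorten every item):
the infinite-volume critical FK-Ising measure on Z^d as a Measure with its connection events, and
`generalised ball` data with the Möbius action;
cite facts wanted: Grimmett2006 Thm 4.19 (thermodynamic limit of wired measures), CamiaFeng2025 Thm
1 / Cor 2 (planar sibling, for the record).

Novelty: Searches (2026-08-16): read all 46 Theses headers of the sub + 93 closed / 38 open idea cards (grep
RSW / one-arm / Camia / IIC / mixing: RSW appears
only as "no RSW in d=3" remarks; Camia–Newman only for CLE/magnetisation-field citations; IIC only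
in engine card far-field-forgets-the-probe and
clause-(iii) cards); `lit search --source crossref "Camia conformal covariance connection
probabilities"` (5: Camia2023 CPAM, CamiaFeng2025 SPA,
Camia–Feng log-CFT papers); `lit read arXiv:2411.01467` (held; Thm 1, Cor 2, Lemmas 12–17, §3.2.3
read); `lit read arXiv:2406.15243` (Panis2025:
Thm 1.1, 2.4, Open Problem 1); `lit search --hybrid "one-arm exponent Ising three dimensions
critical"` (10, none relevant); `lit search --hybrid
"conformal invariance three-dimensional percolation connectivity numerical"` (10 textbook hits);
`lit search --source zbmath "Gori Trombettoni
conformal invariance three dimensional percolation"` (1: doi:10.1088/1742-5468/2015/07/p07014, read: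
crossing probabilities, q = 1);
`lit galaxy search "connection probabilities and fields in 2D critical percolation" --star pdf` (1:
Hutchcroft 2025 citing Camia2023);
`ledger negatives --problem CriticalPhenomena` (10, none in this sub).
Nearest prior art found: CamiaFeng2025 (arXiv:2411.01467) and Camia2023 (doi:10.1002/cpa.22171) —
the planar theorems transferred (CLE + RSW based);
in tree, route CurrentConnectionInvariance (weight-free double-current point ratios + imported
two-point law 0634) and the engine card
fa  [refs: 10.1088/1742-5468/2015/07/p07014, 10.1002/cpa.22171, 2411.01467, 2406.15243, doi:10.1088/1742-5468/2015/07/p07014, doi:10.1002/cpa.22171, Camia2023, CamiaFeng2025, Panis2025]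

Barriers (technique_class: fk-connectivity-transfer, one-arm-dressing, arm-decoupling): - technique_class: fk-connectivity-transfer, one-arm-dressing, arm-decoupling
- Literature.Barriers.CriticalPhenomena.LiouvilleRigidityNarrow: evaded by construction — no
uniformisation, no Loewner chain, no transport between non-Möbius-equivalent domains; the probes are
generalised balls, the one class closed under the Möbius group, and only Möbius covariance is
claimed (the barrier's "NOT blocked" clause).
- Literature.Barriers.CriticalPhenomena.ScaleCovarianceNotMoebius: not engaged — inversion
invariance is an explicit clause of crux A, never deduced from scale + rotation data; the glue
derives inversion covariance of S from A's inversion clause plus the dressing, using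
HasPointwiseScalingLimit-type lattice input throughout; likewise the two-point no-go
`not_twoPointLawMoebiusUpgrade` (TwoPointLawNotMoebius.lean) is evaded, since nothing is deduced
from the two-point law (it is an output).
- Literature.Barriers.CriticalPhenomena.BootstrapLatticeBlindness: not applicable — no CFT data,
every item is a lattice statement about FK-Ising events and criticalCorr 3.
- Literature.Barriers.CriticalPhenomena.IsingTrivialityFromDimensionFour: consistent — cruxes B, C
encode d < 4 (they fail for d >= 5, where one-arm^2 >> two-point and boundary conditions dominate at
criticality); any proof must use a d = 3 input (reflection positivity / ADS continuity /
hyperscaling), and the route says so.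
- Literature.Barriers.CriticalPhenomena.RandomClusterFirstOrder: consistent — B, C, D-type st

History (route lifecycle, newest last):
- 2026-08-16T15:52:02Z · rev 1: restated ArmDressingGlue (stmt-CriticalPhenomena-15649) — repair step 1/2 (glue.non-crux-hypothesis): ArmDressingGlue restated without the support antecedent (ES folded into its proof obligation); closes : A → C → B → (planner-plan-lens-CriticalPhenomena-transfer-v2-0)
- 2026-08-16T16:24:21Z · rev 3: restated OneArmRenormalisedLimit (stmt-CriticalPhenomena-15644), BallConnectivityMoebius (stmt-CriticalPhenomena-15645), ArmExtensionFactorisation (stmt-CriticalPhenomena-15646), EvenPatternDecoupling (stmt-CriticalPhenomena-15647), InfiniteVolumeEdwardsSokal (stmt-CriticalPhenomena-15648), OneArmExponent (stmt- (planner-rrepair-CriticalPhenomena-ArmDressing-7f7aaf78-0)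
- 2026-08-26T06:31:19Z · DORMANT — reconciler: no traction for 8.4 d (last activity item-evidence-added at 2026-08-17T20:26:10Z); parked, not closed — `ledger route dormant route-CriticalPhenomen (operator:999:153921)
- 2026-08-27T15:07:45Z · REACTIVATED — reconciler: reactivated — activity statement-checked at 2026-08-27T13:50:46Z after parking at 2026-08-26T06:31:19Z (operator:999:2783683)

sub-problem: Ising3DConformalLimit · status: open · opened planner-plan-lens-CriticalPhenomena-transfer-v2-0 2026-08-16T15:48:29Z · rev 4 · ledger route-CriticalPhenomena-ArmDressing
GENERATED by the gate from the ledger (D-0016/17). Provers cite these decls: `theorem foo : Summit.CriticalPhenomena.Ising3DConformalLimit.Theses.ArmDressing.<Decl> := …` in Summits/CriticalPhenomena/Ising3DConformalLimit/Theorems/<Name>.lean.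
-/

namespace Summit.CriticalPhenomena.Ising3DConformalLimit.Theses.ArmDressing

open scoped BigOperators Topology Manifold Classical MeasureTheory ProbabilityTheory Matrix InnerProductSpace ComplexConjugate ContinuousMap
open Filter Set Function TopologicalSpace MeasureTheory

attribute [summit_statement] _root_.Ising3DConformalLimit

-- earlier OneArmRenormalisedLimit (stmt-CriticalPhenomena-15644, replaced 2026-08-16T16:24:21Z -> stmt-CriticalPhenomena-16130): retired by None — open Literature.Probability.LatticeModels Literature.Probability.Percolation Literature.Barriers.CriticalPhenomena Filter Topology in let E3 := EuclideanSpace ℝ (Fin 3); let μ : (L : ℕ) → MeasureTheory.Measure (BondConfig (BoxV 3 L)) := fun L => rcMeasure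
/-- item stmt-CriticalPhenomena-16130 · target · rank 0 · open · by planner
why it might fail: it is the conjunct's (i)+(ii) with a specific rho: fails if rho must carry log-corrections relative to the one-arm probability (one-arm and sqrt(two-point) not comparable: a hyperscaling violation expected only for d > 4), or if (ii) fails.
sources: CamiaFeng2025, Camia2023, DuminilCopinICM2022, PolandRychkovVichi2019
[target] X: the one-arm probability arm1(delta,1) = phi[0 <-> (B_(1/delta))^c] (infinite-volume
limit of wired critical FK-Ising boxes on Z^3) is positive, and there are Delta > 0 and S with
HasPointwiseScalingLimit (criticalCorr 3) (1/arm1(·,1)) S, S_2 > 0 on non-coincident pairs,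
IsMoebiusCovariant Delta S — clauses (i),(ii) of the conjunct with the renormalisation PINNED to the
one-arm probability (CamiaFeng2025 remark after Thm 1: without Wu's theorem the normalisation
a^(1/8) is replaced by P[0 <-> dB_1]). [cone repair 2026-08-16: `mesh δ z := WithLp.toLp 2 (fun i =>
δ * z i)` is `Literature.Probability.LatticeModels.meshPos` inlined (rfl), so the statement no
longer imports PlusDomainCorr → GKSInequalities → GibbsStates; meaning unchanged.] -/
@[route_item "route-CriticalPhenomena-ArmDressing"]
def OneArmRenormalisedLimit : Prop :=
  open Literature.Probability.LatticeModels Literature.Probability.Percolation Literature.Barriers.CriticalPhenomena Filter Topology in let E3 := EuclideanSpace ℝ (Fin 3); let μ : (L : ℕ) → MeasureTheory.Measure (BondConfig (BoxV 3 L)) := fun L => rcMeasure (boxGraph 3 L) (fkIsingParam (criticalBeta 3)) 2 (boxBoundary 3 L); let PrL : (m : ℕ) → (Fin m → Set (Site 3)) → Set (Fin m → Fin m → Prop) → ℕ → ℝ := fun _ K R L => (μ L).real {ω | (fun i j => ∃ x y : BoxV 3 L, x.1 ∈ K i ∧ y.1 ∈ K j ∧ (openGraph ω).Reachable x y) ∈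 R}; let Pr : (m : ℕ) → (Fin m → Set (Site 3)) → Set (Fin m → Fin m → Prop) → ℝ := fun m K R => limUnder atTop (PrL m K R); let mesh : ℝ → Site 3 → E3 := fun δ z => WithLp.toLp 2 fun i : Fin 3 => δ * (z i : ℝ); let disc : ℝ → Set E3 → Set (Site 3) := fun δ A => {x | mesh δ x ∈ A}; let arm1 : ℝ → ℝ → ℝ := fun δ r => Pr 2 ![{(0 : Site 3)}, disc δ (Metric.ball (0 : E3) r)ᶜ] {R | R 0 1}; (∀ δ ∈ Set.Ioc (0:ℝ) 1, 0 < arm1 δ 1) ∧ ∃ (Δ : ℝ) (S : CorrFamily 3), 0 < Δ ∧ HasPointwiseScalingLimit (criticalCorr 3) (fun δ => (arm1 δ 1)⁻¹) S ∧ IsNondegenerateTwoPoint S ∧ IsMoebiusCovariant Δ S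

-- earlier BallConnectivityMoebius (stmt-CriticalPhenomena-15645, replaced 2026-08-16T16:24:21Z -> stmt-CriticalPhenomena-16131): retired by None — open Literature.Probability.LatticeModels Literature.Probability.Percolation Literature.Barriers.CriticalPhenomena Filter Topology in let E3 := EuclideanSpace ℝ (Fin 3); let μ : (L : ℕ) → MeasureTheory.Measure (BondConfig (BoxV 3 L)) := fun L => rcMeasure
/-- item stmt-CriticalPhenomena-16131 · crux · rank 2 · open · by planner
why it might fail: the inversion clause is the summit's conformal content in percolation clothing: false if critical 3D FK-Ising clusters were scale- but not Möbius-invariant (no mechanism known; numerics only for q=1, GoriTrombettoni2015); full-filter existence and continuity at tangencies also open.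
sources: Camia2023, CamiaFeng2025, KemppainenSmirnov2017, Smirnov2001, GoriTrombettoni2015, PolandRychkovVichi2019
[crux] THE CLE RESIDUE (first failing step L1 of the sibling proof). For every m and every set R of
relations on m indices, the probability that the critical FK-Ising connection relation among the
discretisations at mesh delta of m GENERALISED BALLS (data (c_i, r_i): r_i > 0 the closed ball, r_i
< 0 the closed exterior of the open ball of radius |r_i|) lies in R converges as delta -> 0+ to a
limit lam(data) which is continuous in the data and INVARIANT under translations, dilations, O(3)
and the unit inversion (acting on data by (c, r) -> (c/(|c|^2 - r^2), r/(|c|^2 - r^2)), which maps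
generalised balls to generalised balls exactly) — the 3D Cardy–Smirnov statement: weight-free,
renormalisation-free, exponent-free. [difficulty: open-problem] [cone repair 2026-08-16: `mesh δ z
:= WithLp.toLp 2 (fun i => δ * z i)` is `Literature.Probability.LatticeModels.meshPos` inlined
(rfl), so the statement no longer imports PlusDomainCorr → GKSInequalities → GibbsStates; meaning
unchanged.] -/
@[route_item "route-CriticalPhenomena-ArmDressing", crux]
def BallConnectivityMoebius : Prop :=
  open Literature.Probability.LatticeModels Literature.Probability.Percolation Literature.Barriers.CriticalPhenomena Filter Topology in let E3 := EuclideanSpace ℝ (Fin 3); let μ : (L : ℕ) → MeasureTheory.Measure (BondConfig (BoxV 3 L)) := fun L => rcMeasure (boxGraph 3 L) (fkIsingParam (criticalBeta 3)) 2 (boxBoundary 3 L); let PrL : (m : ℕ) → (Fin m → Set (Site 3)) → Set (Fin m → Fin m → Prop) → ℕ → ℝ := fun _ K R L => (μ L).real {ω | (fun i j => ∃ x y : BoxV 3 L, x.1 ∈ K i ∧ y.1 ∈ K j ∧ (openGraph ω).Reachable x y) ∈ R}; let Pr : (m : ℕ) → (Fin m → Set (Site 3)) → Set (Fin m → Fin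 m → Prop) → ℝ := fun m K R => limUnder atTop (PrL m K R); let mesh : ℝ → Site 3 → E3 := fun δ z => WithLp.toLp 2 fun i : Fin 3 => δ * (z i : ℝ); let disc : ℝ → Set E3 → Set (Site 3) := fun δ A => {x | mesh δ x ∈ A}; let gball : E3 × ℝ → Set E3 := fun p => if 0 < p.2 then Metric.closedBall p.1 p.2 else (Metric.ball p.1 (-p.2))ᶜ; let ginv : E3 × ℝ → E3 × ℝ := fun p => ((‖p.1‖ ^ 2 - p.2 ^ 2)⁻¹ • p.1, p.2 / (‖p.1‖ ^ 2 - p.2 ^ 2)); ∀ (m : ℕ) (R : Set (Fin m → Fin m → Prop)), ∃ lam : (Fin m → E3 × ℝ) → ℝ, ContinuousOn lam {p | ∀ i, (p i).2 ≠ 0} ∧ (∀ p : Fin m → E3 × ℝ, (∀ i, (p i).2 ≠ 0) → Tendsto (fun δ => Pr m (fun i => disc δ (gball (p i))) R) (𝓝[>] 0) (𝓝 (lam p))) ∧ (∀ (p : Fin m → E3 × ℝ) (u : E3), (∀ i, (p i).2 ≠ 0) → lam (fun i => ((p i).1 + u, (p i).2)) = lam p) ∧ (∀ (p : Fin m → E3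 × ℝ) (κ : ℝ), (∀ i, (p i).2 ≠ 0) → 0 < κ → lam (fun i => (κ • (p i).1, κ * (p i).2)) = lam p) ∧ (∀ (p : Fin m → E3 × ℝ) (A : E3 ≃ₗᵢ[ℝ] E3), (∀ i, (p i).2 ≠ 0) → lam (fun i => (A (p i).1, (p i).2)) = lam p) ∧ (∀ p : Fin m → E3 × ℝ, (∀ i, (p i).2 ≠ 0 ∧ ‖(p i).1‖ ≠ |(p i).2|) → lam (fun i => ginv (p i)) = lam p)

-- earlier ArmExtensionFactorisation (stmt-CriticalPhenomena-15646, replaced 2026-08-16T16:24:21Z -> stmt-CriticalPhenomena-16132): retired by None — open Literature.Probability.LatticeModels Literature.Probability.Percolation Literature.Barriers.CriticalPhenomena Filter Topology in let E3 := EuclideanSpace ℝ (Fin 3); let μ : (L : ℕ) → MeasureTheory.Measure (BondConfig (BoxV 3 L)) := fun L => rcMeasu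
/-- item stmt-CriticalPhenomena-16132 · crux · rank 3 · open · by planner
why it might fail: no RSW/BK in d=3: needs P[two disjoint clusters cross A(r,R)]/P[cross] -> 0 as R/r -> infinity and a one-arm IIC (Panis2025 Open Problem 1, open; even a polynomial rate for <sigma_0>+_(Lambda_R) at beta_c(3) is unproved); false above d_c = 4 where wired spheres over-magnetise (a(R)^2 >> G(R)).
sources: CamiaFeng2025, Panis2025, Kesten1986, AizenmanDuminilCopinAnnals2021, GarbanPeteSchramm2013Pivotal, DuminilCopinHonglerNolin2011
[crux] THE 3D SUBSTITUTE FOR RSW CIRCUITS, NORMALISATION HALF (CamiaFeng2025 Lemmas 15–17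
transposed; = Kesten one-arm conditioning + uniqueness of the annulus-crossing cluster + mixing).
For n >= 1 points z_j inside pairwise disjoint closed balls D_j: (i) the joint arm probability
phi[z_j^delta <-> (D_j^c)^delta for all j] divided by arm1(delta,1)^n converges locally uniformly to
a continuous v(z) > 0; (ii) v(z) = lim_(eta->0) W(eta) / prod_j w(eta a_j) for every choice of
multipliers a_j > 0, where W(eta) is the delta -> 0 then (inner radius -> 0) limit of the ratio
P[inner balls around z_j <-> D_j^c, all j] / P[inner balls <-> B(z_j, eta a_j)^c, all j] — the SAME
limit for every family of inner closed balls shrinking to the points (Kesten: the far field forgets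
how the arm starts) — and w(eta) is the analogous one-point ratio at the origin (outer B(0,1),
middle B(0,eta)); this encodes asymptotic independence of the n point-to-mesoscopic arms (mixing)
and the cancellation of the microscopic hooking factors. [difficulty: XL] [cone repair 2026-08-16:
`mesh δ z := WithLp.toLp 2 (fun i => δ * z i)` is `Literature.Probability.LatticeModels.meshPos`
inlined (rfl), so the statement no l -/
@[route_item "route-CriticalPhenomena-ArmDressing", crux]
def ArmExtensionFactorisation : Prop :=
  open Literature.Probability.LatticeModels Literature.Probability.Percolation Literature.Barriers.CriticalPhenomena Filter Topology in let E3 := EuclideanSpace ℝ (Fin 3); let μ : (L : ℕ) → MeasureTheory.Measure (BondConfig (BoxV 3 L)) := fun L => rcMeasure (boxGraph 3 L) (fkIsingParam (criticalBeta 3)) 2 (boxBoundary 3 L); let PrL : (m : ℕ) → (Fin m → Set (Site 3)) → Set (Fin m → Fin m → Prop) → ℕ → ℝ := fun _ K R L => (μ L).real {ω | (fun i j => ∃ x y : BoxV 3 L, x.1 ∈ K i ∧ y.1 ∈ K j ∧ (openGraph ω).Reachable x y) ∈ R}; let Pr : (m : ℕ) → (Fin m → Set (Site 3)) → Set (Fin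 m → Fin m → Prop) → ℝ := fun m K R => limUnder atTop (PrL m K R); let mesh : ℝ → Site 3 → E3 := fun δ z => WithLp.toLp 2 fun i : Fin 3 => δ * (z i : ℝ); let disc : ℝ → Set E3 → Set (Site 3) := fun δ A => {x | mesh δ x ∈ A}; let arm1 : ℝ → ℝ → ℝ := fun δ r => Pr 2 ![{(0 : Site 3)}, disc δ (Metric.ball (0 : E3) r)ᶜ] {R | R 0 1}; let CROSS : (n : ℕ) → Set (Fin (n + n) → Fin (n + n) → Prop) := fun n => {R | ∀ i : Fin n, R (Fin.castAdd n i) (Fin.natAdd n i)}; let pts : (n : ℕ) → ℝ → (Fin n → E3) → (Fin n → Set (Site 3)) := fun _ δ z j => {latticeApprox δ (z j)}; let fam : (n : ℕ) → ℝ → (Fin n → Set E3) → (Fin n → Set E3) → (Fin (n + n) → Set (Site 3)) := fun _ δ A B => Fin.append (fun j => disc δ (A j)) (fun j => disc δ (B j)); ∀ (n : ℕ), 1 ≤ n → ∀ (c : Fin n → E3) (r : Fin n → ℝ), (∀ j, 0 < r j) → (∀ j k, j ≠ k → Disjoint (Metric.closedBall (c j) (r j)) (Metric.closedBall (c k) (r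 k))) → ∃ v : (Fin n → E3) → ℝ, ContinuousOn v {z | ∀ j, z j ∈ Metric.ball (c j) (r j)} ∧ (∀ z : Fin n → E3, (∀ j, z j ∈ Metric.ball (c j) (r j)) → 0 < v z) ∧ TendstoLocallyUniformlyOn (fun δ z => Pr (n + n) (Fin.append (pts n δ z) (fun j => disc δ (Metric.ball (c j) (r j))ᶜ)) (CROSS n) / (arm1 δ 1) ^ n) v (𝓝[>] 0) {z | ∀ j, z j ∈ Metric.ball (c j) (r j)} ∧ (∀ z : Fin n → E3, (∀ j, z j ∈ Metric.ball (c j) (r j)) → ∀ a : Fin n → ℝ, (∀ j, 0 < a j) → ∃ (W : ℝ → ℝ) (w : ℝ → ℝ), (∀ (ci : ℝ → Fin n → E3) (ri : ℝ → Fin n → ℝ), (∀ j, Tendsto (fun η' => ri η' j) (𝓝[>] 0) (𝓝 0)) → (∀ᶠ η' in 𝓝[>] 0, ∀ j, 0 < ri η' j ∧ z j ∈ Metric.ball (ci η' j) (ri η' j / 2)) → ∀ᶠ η in 𝓝[>] 0, ∃ Λ : ℝ → ℝ, (∀ᶠ η' in 𝓝[>] 0, Tendsto (fun δ => Pr (n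 + n) (fam n δ (fun j => Metric.closedBall (ci η' j) (ri η' j)) (fun j => (Metric.ball (c j) (r j))ᶜ)) (CROSS n) / Pr (n + n) (fam n δ (fun j => Metric.closedBall (ci η' j) (ri η' j)) (fun j => (Metric.ball (z j) (η * a j))ᶜ)) (CROSS n)) (𝓝[>] 0) (𝓝 (Λ η'))) ∧ Tendsto Λ (𝓝[>] 0) (𝓝 (W η))) ∧ (∀ (ci : ℝ → E3) (ri : ℝ → ℝ), Tendsto ri (𝓝[>] 0) (𝓝 0) → (∀ᶠ η' in 𝓝[>] 0, 0 < ri η' ∧ (0 : E3) ∈ Metric.ball (ci η') (ri η' / 2)) → ∀ᶠ η in 𝓝[>] 0, ∃ Λ : ℝ → ℝ, (∀ᶠ η' in 𝓝[>] 0, Tendsto (fun δ => Pr 2 ![disc δ (Metric.closedBall (ci η') (ri η')), disc δ (Metric.ball (0 : E3) 1)ᶜ] {R | R 0 1} / Pr 2 ![disc δ (Metric.closedBall (ci η') (ri η')), disc δ (Metric.ball (0 : E3) η)ᶜ] {R | R 0 1}) (𝓝[>] 0) (𝓝 (Λ η'))) ∧ Tendsto Λ (𝓝[>] 0) (𝓝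 (w η))) ∧ Tendsto (fun η => W η / ∏ j, w (η * a j)) (𝓝[>] 0) (𝓝 (v z)))

-- earlier EvenPatternDecoupling (stmt-CriticalPhenomena-15647, replaced 2026-08-16T16:24:21Z -> stmt-CriticalPhenomena-16133): retired by None — open Literature.Probability.LatticeModels Literature.Probability.Percolation Literature.Barriers.CriticalPhenomena Filter Topology in let E3 := EuclideanSpace ℝ (Fin 3); let μ : (L : ℕ) → MeasureTheory.Measure (BondConfig (BoxV 3 L)) := fun L => rcMeasure (
/-- item stmt-CriticalPhenomena-16133 · crux · rank 4 · open · by planner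
why it might fail: needs uniqueness of the cluster crossing B(z,eta) -> D^c as eta -> 0 (no circuits to merge crossings in 3D; no BK for q=2) and locality of the arm-conditioned measure (one-arm IIC, Panis2025 Open Problem 1); EVEN is non-monotone, so FKG sandwiching alone cannot give (ii).
sources: CamiaFeng2025, Camia2023, GarbanPeteSchramm2013Pivotal, Panis2025, AizenmanDuminilCopinAnnals2021, Kesten1986
[crux] THE 3D SUBSTITUTE FOR RSW CIRCUITS, PATTERN HALF (CamiaFeng2025 Lemmas 12 and 14 transposed).
For even n >= 2 and points z_j inside pairwise disjoint closed balls D_j: (i) the conditional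
probability P[EVEN(z): every open cluster contains an even number of the points z_j^delta |
z_j^delta <-> (D_j^c)^delta for all j] converges locally uniformly to a continuous q(z) > 0; (ii)
q(z) equals the eta -> 0 limit of the delta -> 0 limits of P[EVEN among inner balls, and inner
ball_j <-> D_j^c for all j] / P[inner ball_j <-> D_j^c for all j] for EVERY family of inner closed
balls of radii -> 0 containing the points well inside — point-conditioning = ball-conditioning
(Kesten decoupling), with the even pattern read on the unique crossing clusters. [difficulty: L]
[cone repair 2026-08-16: `mesh δ z := WithLp.toLp 2 (fun i => δ * z i)` is
`Literature.Probability.LatticeModels.meshPos` inlined (rfl), so the statement no longer imports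
PlusDomainCorr → GKSInequalities → GibbsStates; meaning unchanged.] -/
@[route_item "route-CriticalPhenomena-ArmDressing", crux]
def EvenPatternDecoupling : Prop :=
  open Literature.Probability.LatticeModels Literature.Probability.Percolation Literature.Barriers.CriticalPhenomena Filter Topology in let E3 := EuclideanSpace ℝ (Fin 3); let μ : (L : ℕ) → MeasureTheory.Measure (BondConfig (BoxV 3 L)) := fun L => rcMeasure (boxGraph 3 L) (fkIsingParam (criticalBeta 3)) 2 (boxBoundary 3 L); let PrL : (m : ℕ) → (Fin m → Set (Site 3)) → Set (Fin m → Fin m → Prop) → ℕ → ℝ := fun _ K R L => (μ L).real {ω | (fun i j => ∃ x y : BoxV 3 L, x.1 ∈ K i ∧ y.1 ∈ K j ∧ (openGraph ω).Reachable x y) ∈ R}; let Pr : (m : ℕ) → (Fin m → Set (Site 3)) → Set (Fin m → Fin m → Prop) → ℝ := fun m K R => limUnder atTop (PrL m K R); let mesh : ℝ → Site 3 → E3 := fun δ z => WithLp.toLp 2 fun i : Fin 3 => δ * (z i : ℝ); let disc : ℝ → Set E3 → Set (Site 3) := fun δ A => {x | mesh δ x ∈ A}; let EVEN : (n : ℕ)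 → Set (Fin n → Fin n → Prop) := fun n => {R | ∀ i, Even ({j : Fin n | R i j}.ncard)}; let EVEN2 : (n : ℕ) → Set (Fin (n + n) → Fin (n + n) → Prop) := fun n => {R | ∀ i : Fin n, Even ({j : Fin n | R (Fin.castAdd n i) (Fin.castAdd n j)}.ncard)}; let CROSS : (n : ℕ) → Set (Fin (n + n) → Fin (n + n) → Prop) := fun n => {R | ∀ i : Fin n, R (Fin.castAdd n i) (Fin.natAdd n i)}; let pts : (n : ℕ) → ℝ → (Fin n → E3) → (Fin n → Set (Site 3)) := fun _ δ z j => {latticeApprox δ (z j)}; let fam : (n : ℕ) → ℝ → (Fin n → Set E3) → (Fin n → Set E3) → (Fin (n + n) → Set (Site 3)) := fun _ δ A B => Fin.append (fun j => disc δ (A j)) (fun j => disc δ (B j)); ∀ (n : ℕ), 2 ≤ n → Even n → ∀ (c : Fin n → E3) (r : Fin n → ℝ), (∀ j, 0 < r j) → (∀ j k, j ≠ k → Disjoint (Metric.closedBall (c j) (r j)) (Metric.closedBall (c k) (r k))) → ∃ q : (Fin n → E3) → ℝ, ContinuousOn q {z | ∀ j, z j ∈ Metric.ball (c j) (r j)}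 ∧ (∀ z : Fin n → E3, (∀ j, z j ∈ Metric.ball (c j) (r j)) → 0 < q z) ∧ TendstoLocallyUniformlyOn (fun δ z => Pr n (pts n δ z) (EVEN n) / Pr (n + n) (Fin.append (pts n δ z) (fun j => disc δ (Metric.ball (c j) (r j))ᶜ)) (CROSS n)) q (𝓝[>] 0) {z | ∀ j, z j ∈ Metric.ball (c j) (r j)} ∧ (∀ z : Fin n → E3, (∀ j, z j ∈ Metric.ball (c j) (r j)) → ∀ (ci : ℝ → Fin n → E3) (ri : ℝ → Fin n → ℝ), (∀ j, Tendsto (fun η => ri η j) (𝓝[>] 0) (𝓝 0)) → (∀ᶠ η in 𝓝[>] 0, ∀ j, 0 < ri η j ∧ z j ∈ Metric.ball (ci η j) (ri η j / 2)) → ∃ Λ : ℝ → ℝ, (∀ᶠ η in 𝓝[>] 0, Tendsto (fun δ => Pr (n + n) (fam n δ (fun j => Metric.closedBall (ci η j) (ri η j)) (fun j => (Metric.ball (c j) (r j))ᶜ)) (EVEN2 n ∩ CROSS n) / Pr (n + n) (fam n δ (fun j => Metric.closedBall (ci η j) (ri η j)) (fun j => (Metric.ball (c j) (r j))ᶜ))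 (CROSS n)) (𝓝[>] 0) (𝓝 (Λ η))) ∧ Tendsto Λ (𝓝[>] 0) (𝓝 (q z)))

/-- item stmt-CriticalPhenomena-0636 · crux · rank 5 · open · by planner
why it might fail: it is clause (iii) itself for every renormalisation: fails iff some non-degenerate limit of critical 3D Ising is Gaussian (two independent sourced currents avoid each other at macroscopic separation), which would refute the conjunct.
sources: Aizenman1982, AizenmanDuminilCopinAnnals2021, DuminilCopinICM2022
Crux r4 (non-triviality in d=3): every non-degenerate pointwise scaling limit S of the renormalised
critical Ising correlators on Z^3 has connected four-point function U4 ≢ 0 on non-coincident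
configurations. Intended tool: the random-current identity U4(x,y,z,t) =
−2⟨σxσy⟩⟨σzσt⟩·P^{xy,zt}[C_{n1+n2}(x) ∩ C_{n1+n2}(z) ≠ ∅] (Aizenman 1982; ADC2021 arXiv:1912.07973
eq. (3.11)): non-Gaussianity ⇔ the intersection probability of the two double-current clusters at
macroscopic separation does not vanish as δ → 0. Contrast: for d ≥ 4 every such limit IS Gaussian
(Literature.Probability.LatticeModels.highDim_triviality). Its negation refutes the conjunct
Ising3DConformalLimit itself. -/
@[route_item "route-CriticalPhenomena-ArmDressing", crux]
def NonGaussianLimit : Prop :=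
  ∀ (ρ : ℝ → ℝ) (S : Literature.Probability.LatticeModels.CorrFamily 3), (∀ δ ∈ Set.Ioc (0:ℝ) 1, 0 < ρ δ) → Literature.Probability.LatticeModels.HasPointwiseScalingLimit (Literature.Probability.LatticeModels.criticalCorr 3) ρ S → Literature.Probability.LatticeModels.IsNondegenerateTwoPoint S → Literature.Probability.LatticeModels.HasNontrivialU4 S

-- earlier ArmDressingGlue (stmt-CriticalPhenomena-15649, replaced 2026-08-16T15:52:02Z -> stmt-CriticalPhenomena-15700): retired by None — InfiniteVolumeEdwardsSokal → BallConnectivityMoebius → EvenPatternDecoupling → ArmExtensionFactorisation → OneArmRenormalisedLimit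
/-- item stmt-CriticalPhenomena-15700 · crux · rank 9 · closed · proved by Summit.CriticalPhenomena.Ising3DConformalLimit.Theorems.armDressing_armDressingGlue_proof @ b6c1b4b5e8d1 (prover) · by planner
why it might fail: Only as a formal implication: if a robustness clause the CF25 bookkeeping silently needs (continuity of q,v; inner-family independence; antitonicity in the middle ball; O(eta^2) off-centring under inversion) is missing from A/B/C as typed, the glue is unprovable and inputs must be restated.
sources: CamiaFeng2025, Camia2023, GarbanPeteSchramm2013Pivotal
THE ASSEMBLY MATHEMATICS, this route's own proof obligation: the covariance bookkeeping of
CamiaFeng2025 §3.2.2–3.2.3 transposed to R^3 plus the infinite-volume Edwards–Sokal identity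
(support InfiniteVolumeEdwardsSokal, to be landed first and invoked inside the proof): from A, B, C
build S_n := q·v with the one-arm renormalisation, exact lattice dilation covariance ⇒ t(κ)=κ^(-Δ),
Δ∈[1/2,1] from the proved two-point window, translations/O(3)/inversion from A via the
identifications B(ii), C(ii) (inner-family independence, antitonicity in the middle ball,
w(η/s_j)/w(η) → s_j^(-Δ)). -/
@[route_item "route-CriticalPhenomena-ArmDressing", crux]
def ArmDressingGlue : Prop :=
  BallConnectivityMoebius → EvenPatternDecoupling → ArmExtensionFactorisation → OneArmRenormalisedLimit

-- `ArmDressingGlue` holds: proved by `Summit.CriticalPhenomena.Ising3DConformalLimit.Theorems.armDressing_armDressingGlue_proof` @ b6c1b4b5e8d1 (its module imports this route file, so no `_holds` link can be stated here).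

-- earlier InfiniteVolumeEdwardsSokal (stmt-CriticalPhenomena-15648, replaced 2026-08-16T16:24:21Z -> stmt-CriticalPhenomena-16134): retired by None — open Literature.Probability.LatticeModels Literature.Probability.Percolation Literature.Barriers.CriticalPhenomena Filter Topology in let E3 := EuclideanSpace ℝ (Fin 3); let μ : (L : ℕ) → MeasureTheory.Measure (BondConfig (BoxV 3 L)) := fun L => rcMeas
/-- item stmt-CriticalPhenomena-16134 · support · rank 9 · open · by planner
sources: EdwardsSokal1988, Grimmett2006, AizenmanDuminilCopinSidoravicius2015, CamiaFeng2025
[support] (a) for every finite family of lattice sets whose infinite members pairwise intersect and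
every relation set R, the wired-box probabilities PrL(L) of "the connection relation lies in R"
converge as L -> infinity (weak limit of wired critical FK-Ising measures + no percolation at p_c(2)
on Z^3, AizenmanDuminilCopinSidoravicius2015; Grimmett2006 Thm 4.19, Prop 5.11), so every Pr in the
cruxes is a genuine limit; (b) arm1(delta,1) > 0 on (0,1] (Griffiths: >= <sigma_0 sigma_x> > 0); (c)
Edwards–Sokal with + boundary in infinite volume at beta_c: criticalCorr 3 n x = Pr[EVEN(x)] for
injective x (finite-volume ES with the boundary cluster frozen +,
isingCorr_plus_box_eq_rcMeasure_real pattern, then L -> infinity using m*(beta_c) = 0: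
spontaneousMagnetization_criticalBeta_eq_zero). [difficulty: provable-now] [cone repair 2026-08-16:
`mesh δ z := WithLp.toLp 2 (fun i => δ * z i)` is `Literature.Probability.LatticeModels.meshPos`
inlined (rfl), so the statement no longer imports PlusDomainCorr → GKSInequalities → GibbsStates;
meaning unchanged.] -/
@[route_item "route-CriticalPhenomena-ArmDressing"]
def InfiniteVolumeEdwardsSokal : Prop :=
  open Literature.Probability.LatticeModels Literature.Probability.Percolation Literature.Barriers.CriticalPhenomena Filter Topology in let E3 := EuclideanSpace ℝ (Fin 3); let μ : (L : ℕ) → MeasureTheory.Measure (BondConfig (BoxV 3 L)) := fun L => rcMeasure (boxGraph 3 L) (fkIsingParam (criticalBeta 3)) 2 (boxBoundary 3 L); let PrL : (m : ℕ) → (Fin m → Set (Site 3)) → Set (Fin m → Fin m → Prop) → ℕ → ℝ := fun _ K R L => (μ L).real {ω | (fun i j => ∃ x y : BoxV 3 L, x.1 ∈ K i ∧ y.1 ∈ K j ∧ (openGraph ω).Reachable x y) ∈ R}; let Pr : (m : ℕ) → (Fin m → Set (Site 3)) → Set (Fin m → Fin m → Prop) → ℝ := fun m K R => limUnder atTop (PrL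 m K R); let mesh : ℝ → Site 3 → E3 := fun δ z => WithLp.toLp 2 fun i : Fin 3 => δ * (z i : ℝ); let disc : ℝ → Set E3 → Set (Site 3) := fun δ A => {x | mesh δ x ∈ A}; let arm1 : ℝ → ℝ → ℝ := fun δ r => Pr 2 ![{(0 : Site 3)}, disc δ (Metric.ball (0 : E3) r)ᶜ] {R | R 0 1}; let EVEN : (n : ℕ) → Set (Fin n → Fin n → Prop) := fun n => {R | ∀ i, Even ({j : Fin n | R i j}.ncard)}; (∀ (m : ℕ) (K : Fin m → Set (Site 3)) (R : Set (Fin m → Fin m → Prop)), (∀ i j, i ≠ j → (K i).Infinite → (K j).Infinite → (K i ∩ K j).Nonempty) → ∃ l : ℝ, Tendsto (PrL m K R) atTop (𝓝 l)) ∧ (∀ δ ∈ Set.Ioc (0:ℝ) 1, 0 < arm1 δ 1) ∧ ∀ (n : ℕ) (x : Fin n → Site 3), Function.Injective x → criticalCorr 3 n x = Pr n (fun j => {x j}) (EVEN n)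

-- earlier OneArmExponent (stmt-CriticalPhenomena-15650, replaced 2026-08-16T16:24:21Z -> stmt-CriticalPhenomena-16135): retired by None — open Literature.Probability.LatticeModels Literature.Probability.Percolation Literature.Barriers.CriticalPhenomena Filter Topology in let E3 := EuclideanSpace ℝ (Fin 3); let μ : (L : ℕ) → MeasureTheory.Measure (BondConfig (BoxV 3 L)) := fun L => rcMeasure (boxGrap
/-- item stmt-CriticalPhenomena-16135 · support · rank 9 · open · by planner
sources: Panis2025, KozmaNachmias2011, LawlerSchrammWerner2002OneArm, PolandRychkovVichi2019
[support] milestone dividend (provable from ArmExtensionFactorisation at n = 1 plus the dilation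
part of the glue and the proved two-point window): the one-arm exponent of critical FK-Ising on Z^3
exists as a RATIO LIMIT, arm1(delta, r)/arm1(delta, 1) -> r^(-Delta) with Delta in [1/2, 1]
(prediction Delta = Delta_sigma = 0.5181489). [difficulty: M] [cone repair 2026-08-16: `mesh δ z :=
WithLp.toLp 2 (fun i => δ * z i)` is `Literature.Probability.LatticeModels.meshPos` inlined (rfl),
so the statement no longer imports PlusDomainCorr → GKSInequalities → GibbsStates; meaning
unchanged.] -/
@[route_item "route-CriticalPhenomena-ArmDressing"]
def OneArmExponent : Prop :=
  open Literature.Probability.LatticeModels Literature.Probability.Percolation Literature.Barriers.CriticalPhenomena Filter Topology in let E3 := EuclideanSpace ℝ (Fin 3); let μ : (L : ℕ) → MeasureTheory.Measure (BondConfig (BoxV 3 L)) := fun L => rcMeasure (boxGraph 3 L) (fkIsingParam (criticalBeta 3)) 2 (boxBoundary 3 L); let PrL : (m : ℕ) → (Fin m → Set (Site 3)) → Set (Fin m → Fin m → Prop) → ℕ → ℝ := fun _ K R L => (μ L).real {ω | (fun i j => ∃ x y : BoxV 3 L, x.1 ∈ K i ∧ y.1 ∈ K j ∧ (openGraph ω).Reachable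 x y) ∈ R}; let Pr : (m : ℕ) → (Fin m → Set (Site 3)) → Set (Fin m → Fin m → Prop) → ℝ := fun m K R => limUnder atTop (PrL m K R); let mesh : ℝ → Site 3 → E3 := fun δ z => WithLp.toLp 2 fun i : Fin 3 => δ * (z i : ℝ); let disc : ℝ → Set E3 → Set (Site 3) := fun δ A => {x | mesh δ x ∈ A}; let arm1 : ℝ → ℝ → ℝ := fun δ r => Pr 2 ![{(0 : Site 3)}, disc δ (Metric.ball (0 : E3) r)ᶜ] {R | R 0 1}; ∃ Δ ∈ Set.Icc (1/2 : ℝ) 1, ∀ r : ℝ, 0 < r → Tendsto (fun δ => arm1 δ r / arm1 δ 1) (𝓝[>] 0) (𝓝 (r ^ (-Δ)))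

/-- item stmt-CriticalPhenomena-15651 · assembly · rank 1 · open · by planner
sources: CamiaFeng2025, DuminilCopinICM2022
[assembly] ArmDressingGlue → InfiniteVolumeEdwardsSokal → BallConnectivityMoebius →
EvenPatternDecoupling → ArmExtensionFactorisation → NonGaussianLimit → the conjunct (pure logic:
unpack the target, rho := 1/arm1 > 0, apply NonGaussianLimit). -/
@[route_item "route-CriticalPhenomena-ArmDressing"]
def Assembly : Prop :=
  ArmDressingGlue → InfiniteVolumeEdwardsSokal → BallConnectivityMoebius → EvenPatternDecoupling → ArmExtensionFactorisation → NonGaussianLimit → Ising3DConformalLimit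

/-! D-0027 §2.1 — DECIDING THEOREM (planner-authored via `route open/edit --closes-file`; by planner-plan-lens-CriticalPhenomena-transfer-v2-0 2026-08-16T15:52:02Z):
its hypotheses are this route's items and its conclusion the sub-problem Statement (glue_lint), and it elaborates with this file. -/

@[closes "route-CriticalPhenomena-ArmDressing"] theorem closes (hA : BallConnectivityMoebius) (hC : ArmExtensionFactorisation)
    (hB : EvenPatternDecoupling) (hNG : NonGaussianLimit)
    (hG : ArmDressingGlue) : Ising3DConformalLimit := by
  obtain ⟨hpos, Δ, S, hΔ, hlim, hnd, hM⟩ := hG hA hB hC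
  refine ⟨_, Δ, S, ?_, hΔ, hlim, hnd, hM, hNG _ S ?_ hlim hnd⟩ <;>
  · intro δ hδ
    exact inv_pos.mpr (hpos δ hδ)

end Summit.CriticalPhenomena.Ising3DConformalLimit.Theses.ArmDressing
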